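import Mathlib
import HarnessLib
import Summits.PneNP.PneNP.Theorems.AeaCutRectanglesTransversalEngine
import Summits.PneNP.PneNP.Theorems.AeaCutRectanglesDutyRectangles
import Summits.PneNP.PneNP.Theorems.AeaCutRectanglesClassCuts
import Summits.PneNP.PneNP.Theorems.AeaCutRectanglesSparseCoreLemmaSix

/-!
# Crux `FoolingMeasure` (stmt-PneNP-19727) — p4 g11: the TRIPARTITE CUT WALL (B8) for the transversal engine

Seat pnp-ideate-p4 (planner; lens «barrier inversion», applied at crux level), generation 11.  Companion memo:
`Cruxes/FoolingMeasure/BarrierNotesP4g11.md` (§1–§2 = this file in prose, tightness, the window-end form).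
Sorry-free; imports only `Theorems/…` of the route (never another crux workfile).

HONEST FRAMING.  Elementary counting about the HYPOTHESIS of one engine (the uniform transversal measure,
`AeaCutRectanglesTransversalEngine` / `AeaCutRectanglesFixedCutFooling.foolingMeasure_of_spreadSystem`, and its
robust version `Cruxes/FoolingMeasure/RobustEngine.lean`) for ONE crux (X1 = `AeaCutRectangles.FoolingMeasure`) of a
FRONTIER route (a rung of Fagin's complement ladder: NON-3-COL ∉ monadic-Σ¹₁ with built-in successor, via AEA cut
rectangles).  Nothing here bears on P vs NP.

## What is proved

§1 `exists_cut_few_inside` — pure finite combinatorics.  A family `e : ι → Sym2 V` of loopless pairs, properly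
   3-coloured by `κ : V → Fin 3` (every pair bichromatic), `2h ≤ |V| ≤ 3h`: some `h`-set `B ⊆ V` has
   `#{i : e i ⊆ B} · 3|V| ≤ |ι| · (3h − |V|)`; at `h = |V|/2` at most `|ι|/6` pairs inside.  Proof: if a colour
   class has `≥ h` vertices take `B` inside it (no pair inside); else for every ORDERED pair of colours `(a,b)`
   the set `X_a ∪ (the h − |X_a| vertices of X_b lightest towards X_a)` holds `≤ N_ab (h − |X_a|)/|X_b|` pairs
   (`AeaCutRectanglesSparseCoreLemmaSix.exists_subset_small_weight`); summing the two orientations per colour pair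
   and AM–HM over the three class-pair sizes (`amhm_aux`, `six_orient_contra`) gives the bound.  This is the
   lead prover's support-graph argument of p573995 (`halfSparse_of_core_lt_three`: a 3-colourable core has a
   half spanning ≤ |core|/6 edges) run for an arbitrary properly coloured PAIR FAMILY and a RELATIVE size `h`.
§2 `splitUnits_le_of_witness` / `_of_colorable_off` / `_of_D2` / `_of_robustD2` — for a system `π` of `m` units
   of two loopless pairs on `Fin n` and a 3-colouring of `Γ − π_J` (a D2-witness, `J = {i}`; a `D2ᵣ`-witness,
   `|J| = r`), some `h`-set splits (`AeaCutRectanglesClassCuts.splitUnits`) at most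
   `|J| + 2(m − |J|)(3h − n)/(3n)` units, for every `h` with `2h ≤ n ≤ 3h`.
§3 `three_mul_demand_le_of_exactSpreadAt` — in the VERBATIM shape of the landed spread reduction at one `n ≥ 2`
   with `ε·n ≥ 1/2`: D1 ∧ D2 ∧ SPREAD(T = (n/2)·log₂ n + C·n on the ε-window) force **`3T ≤ m + 2`**, i.e.
   `m ≥ (3/2)·n·log₂ n + 3C·n − 2`; robust: `three_mul_le_of_spreadAt_half_robust`, `3T ≤ m + 2r` under `D2ᵣ`.
   (g5 UNIT FLOOR `P4g5.exists_bisection_splits_le_half`: `m ≥ n·log₂ n + 2Cn`; random bisection: `(8/3)T`.)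
   The general `h` of §2 gives at the window end `h = (1/2 − ε)n`: `m − r ≥ 3(T − r)/(1 − 6ε)` (memo §2), so
   SPREAD on the full window is impossible for `ε ≥ 1/6` whatever `m` (known in substance since g3 (3a)).

TIGHT: uniformly random pairs between three balanced classes have `≈ |ι|(3h − n)/(3n)` pairs inside EVERY
`h`-set built from classes, and `K₃^{×k}`-overlay witnesses give exactly `|ι|/6` at `h = n/2` (memo §1.3); so
the single-witness class-cut method caps at the unit fraction `1/3` of `m` and cannot by itself refute SPREAD for
`m ≥ 3T` — the engine's NO-SPREAD question (memo §3) needs D1, which no wall so far uses.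
-/

set_option linter.dupNamespace false
set_option linter.unusedSectionVars false
set_option autoImplicit false

namespace Summit.PneNP.PneNP.Cruxes.FoolingMeasure.P4g11

open Finset
open Summit.PneNP.PneNP.Theorems.AeaCutRectanglesTransversalEngine
open Summit.PneNP.PneNP.Theorems.AeaCutRectanglesDutyRectangles
open Summit.PneNP.PneNP.Theorems.AeaCutRectanglesClassCuts
open Summit.PneNP.PneNP.Theorems.AeaCutRectanglesSparseCoreLemmaSix

/-! ### §0  Two real-number lemmas -/

/-- `p/q + q/p ≥ 2` for positive reals. -/
theorem two_le_div_add_div {p q : ℝ} (hp : 0 < p) (hq : 0 < q) : 2 ≤ p / q + q / p := by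
  rw [div_add_div _ _ hq.ne' hp.ne', le_div_iff₀ (mul_pos hq hp)]
  nlinarith [sq_nonneg (p - q)]

/-- **AM–HM step.**  If `sₐ < 2h` (all three) and `s₀ + s₁ + s₂ = 2n`, then
`3n/(3h − n) ≤ Σ sₐ/(2h − sₐ)`.  (With `y = 2h − s`: `Σ (2h − y)/y = 2h·Σ 1/y − 3 ≥ 18h/Σy − 3`.) -/
theorem amhm_aux {s₀ s₁ s₂ hh nn : ℝ} (h0 : 0 < 2 * hh - s₀) (h1 : 0 < 2 * hh - s₁) (h2 : 0 < 2 * hh - s₂)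
    (hh0 : 0 ≤ hh) (hsum : s₀ + s₁ + s₂ = 2 * nn) :
    3 * nn / (3 * hh - nn) ≤ s₀ / (2 * hh - s₀) + s₁ / (2 * hh - s₁) + s₂ / (2 * hh - s₂) := by
  set y₀ := 2 * hh - s₀ with hy₀
  set y₁ := 2 * hh - s₁ with hy₁
  set y₂ := 2 * hh - s₂ with hy₂
  have hys : y₀ + y₁ + y₂ = 6 * hh - 2 * nn := by rw [hy₀, hy₁, hy₂]; linarith
  have hpos : 0 < 3 * hh - nn := by linarith
  have key : 9 / (y₀ + y₁ + y₂) ≤ 1 / y₀ + 1 / y₁ + 1 / y₂ := by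
    rw [div_le_iff₀ (by linarith)]
    have e : (1 / y₀ + 1 / y₁ + 1 / y₂) * (y₀ + y₁ + y₂)
        = 3 + (y₀ / y₁ + y₁ / y₀) + (y₀ / y₂ + y₂ / y₀) + (y₁ / y₂ + y₂ / y₁) := by
      field_simp
      ring
    rw [e]
    linarith [two_le_div_add_div h0 h1, two_le_div_add_div h0 h2, two_le_div_add_div h1 h2]
  have es : ∀ s y : ℝ, y = 2 * hh - s → y ≠ 0 → s / y = 2 * hh * (1 / y) - 1 := by
    intro s y hy hne
    rw [hy] at hne ⊢
    field_simp
    ring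
  rw [es s₀ y₀ hy₀ h0.ne', es s₁ y₁ hy₁ h1.ne', es s₂ y₂ hy₂ h2.ne']
  have e3 : 3 * nn / (3 * hh - nn) = 2 * hh * (9 / (y₀ + y₁ + y₂)) - 3 := by
    rw [hys, eq_sub_iff_add_eq, div_add' _ _ _ hpos.ne', mul_div_assoc', div_eq_div_iff hpos.ne' (by linarith)]
    ring
  rw [e3]
  have := mul_le_mul_of_nonneg_left key (by linarith : (0:ℝ) ≤ 2 * hh)
  linarith

/-! ### §1  Properly 3-coloured pair families: an `h`-set containing few pairs -/

section Tripartite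

variable {V ι : Type*} [Fintype V] [DecidableEq V] [Fintype ι] [DecidableEq ι]

/-- The indices of the pairs lying inside `B`. -/
def insideIdx (e : ι → Sym2 V) (B : Finset V) : Finset ι :=
  univ.filter fun i => ∀ v ∈ e i, v ∈ B

/-- The colour class of `a`. -/
def cls (κ : V → Fin 3) (a : Fin 3) : Finset V :=
  univ.filter fun v => κ v = a

/-- The pairs at `v` whose other endpoint has colour `a`. -/
def star (e : ι → Sym2 V) (κ : V → Fin 3) (a : Fin 3) (v : V) : Finset ι :=
  univ.filter fun i => v ∈ e i ∧ ∀ u ∈ e i, u = v ∨ κ u = a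

/-- The pairs coloured exactly `{a, b}`. -/
def btw (e : ι → Sym2 V) (κ : V → Fin 3) (a b : Fin 3) : Finset ι :=
  univ.filter fun i => (e i).map κ = s(a, b)

theorem mem_insideIdx {e : ι → Sym2 V} {B : Finset V} {i : ι} :
    i ∈ insideIdx e B ↔ ∀ v ∈ e i, v ∈ B := by
  simp [insideIdx]

theorem mem_cls {κ : V → Fin 3} {a : Fin 3} {v : V} : v ∈ cls κ a ↔ κ v = a := by
  simp [cls]

theorem mem_star {e : ι → Sym2 V} {κ : V → Fin 3} {a : Fin 3} {v : V} {i : ι} :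
    i ∈ star e κ a v ↔ v ∈ e i ∧ ∀ u ∈ e i, u = v ∨ κ u = a := by
  simp [star]

theorem mem_btw {e : ι → Sym2 V} {κ : V → Fin 3} {a b : Fin 3} {i : ι} :
    i ∈ btw e κ a b ↔ (e i).map κ = s(a, b) := by
  simp [btw]

/-- Every unordered pair is `s(x, y)` for some `x, y`. -/
theorem exists_eq_mk (z : Sym2 V) : ∃ x y : V, z = s(x, y) := by
  induction z using Sym2.ind with
  | h x y => exact ⟨x, y, rfl⟩

/-- The three classes partition the vertex set. -/
theorem card_cls_sum (κ : V → Fin 3) :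
    (cls κ 0).card + (cls κ 1).card + (cls κ 2).card = Fintype.card V := by
  have h := card_eq_sum_card_fiberwise (s := (univ : Finset V)) (t := (univ : Finset (Fin 3))) (f := κ)
    fun _ _ => mem_univ _
  rw [Fin.sum_univ_three] at h
  rw [← card_univ, h]
  rfl

/-- The colour-pair predicate is symmetric. -/
theorem btw_comm (e : ι → Sym2 V) (κ : V → Fin 3) (a b : Fin 3) : btw e κ a b = btw e κ b a := by
  unfold btw
  congr 1
  ext i
  rw [Sym2.eq_swap]

/-- The three colour-pair classes have at most `|ι|` members in total. -/
theorem card_btw_sum_le (e : ι → Sym2 V) (κ : V → Fin 3) :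
    (btw e κ 0 1).card + (btw e κ 0 2).card + (btw e κ 1 2).card ≤ Fintype.card ι := by
  classical
  have key : ∀ a b c d : Fin 3, s(a, b) ≠ s(c, d) → Disjoint (btw e κ a b) (btw e κ c d) := by
    intro a b c d hne
    rw [Finset.disjoint_left]
    intro i h1 h2
    rw [mem_btw] at h1 h2
    exact hne (h1.symm.trans h2)
  have hd1 : Disjoint (btw e κ 0 1) (btw e κ 0 2) := key 0 1 0 2 (by decide)
  have hd2 : Disjoint (btw e κ 0 1 ∪ btw e κ 0 2) (btw e κ 1 2) := by
    rw [disjoint_union_left]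
    exact ⟨key 0 1 1 2 (by decide), key 0 2 1 2 (by decide)⟩
  calc (btw e κ 0 1).card + (btw e κ 0 2).card + (btw e κ 1 2).card
      = (btw e κ 0 1 ∪ btw e κ 0 2 ∪ btw e κ 1 2).card := by
        rw [card_union_of_disjoint hd2, card_union_of_disjoint hd1]
    _ ≤ Fintype.card ι := card_le_univ _

/-- **Inside pairs of `X_a ∪ T` (`T ⊆ X_b`) are `T`–`X_a` pairs.**  For a properly coloured loopless
family, the pairs inside `X_a ∪ T` are covered by the stars `star a v`, `v ∈ T`. -/
theorem card_insideIdx_union_le {e : ι → Sym2 V} {κ : V → Fin 3}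
    (hb : ∀ i, ¬ ((e i).map κ).IsDiag) {a b : Fin 3} {T : Finset V} (hT : T ⊆ cls κ b) :
    (insideIdx e (cls κ a ∪ T)).card ≤ ∑ v ∈ T, (star e κ a v).card := by
  classical
  refine le_trans (card_le_card ?_) card_biUnion_le
  intro i hi
  rw [mem_insideIdx] at hi
  rw [mem_biUnion]
  obtain ⟨x, y, hxy⟩ := exists_eq_mk (e i)
  have hκ : κ x ≠ κ y := fun h => hb i (by rw [hxy, Sym2.map_mk]; exact Sym2.mk_isDiag_iff.2 h)
  have hx : x ∈ cls κ a ∪ T := hi x (by rw [hxy]; exact Sym2.mem_mk_left x y)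
  have hy : y ∈ cls κ a ∪ T := hi y (by rw [hxy]; exact Sym2.mem_mk_right x y)
  rw [mem_union, mem_cls] at hx hy
  rcases hx with hxa | hxT
  · have hyT : y ∈ T := by
      rcases hy with hya | hyT
      · exact absurd (hxa.trans hya.symm) hκ
      · exact hyT
    refine ⟨y, hyT, ?_⟩
    rw [mem_star, hxy]
    refine ⟨Sym2.mem_mk_right x y, fun u hu => ?_⟩
    rcases Sym2.mem_iff.1 hu with rfl | rfl
    · exact Or.inr hxa
    · exact Or.inl rfl
  · have hxb : κ x = b := mem_cls.1 (hT hxT)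
    have hya : κ y = a := by
      rcases hy with hya | hyT
      · exact hya
      · exact absurd (hxb.trans (mem_cls.1 (hT hyT)).symm) hκ
    refine ⟨x, hxT, ?_⟩
    rw [mem_star, hxy]
    refine ⟨Sym2.mem_mk_left x y, fun u hu => ?_⟩
    rcases Sym2.mem_iff.1 hu with rfl | rfl
    · exact Or.inl rfl
    · exact Or.inr hya

/-- **The stars at `X_b` towards colour `a` are disjoint parts of the `{a,b}`-coloured pairs.** -/
theorem sum_card_star_le {e : ι → Sym2 V} {κ : V → Fin 3} (hl : ∀ i, ¬ (e i).IsDiag) {a b : Fin 3}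
    (hab : a ≠ b) : ∑ v ∈ cls κ b, (star e κ a v).card ≤ (btw e κ a b).card := by
  classical
  have hdisj : ((cls κ b : Finset V) : Set V).PairwiseDisjoint (star e κ a) := by
    intro v hv v' hv' hne
    change Disjoint (star e κ a v) (star e κ a v')
    rw [Finset.disjoint_left]
    intro i h1 h2
    rw [mem_star] at h1 h2
    have hv'b : κ v' = b := mem_cls.1 (mem_coe.1 hv')
    rcases h1.2 v' h2.1 with h | h
    · exact hne h.symm
    · exact hab (h.symm.trans hv'b)
  rw [← card_biUnion hdisj]
  refine card_le_card fun i hi => ?_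
  rw [mem_biUnion] at hi
  obtain ⟨v, hv, hiv⟩ := hi
  rw [mem_star] at hiv
  rw [mem_btw]
  obtain ⟨x, y, hxy⟩ := exists_eq_mk (e i)
  have hne : x ≠ y := fun h => hl i (by rw [hxy]; exact Sym2.mk_isDiag_iff.2 h)
  have hvb : κ v = b := mem_cls.1 hv
  rw [hxy] at hiv ⊢
  rw [Sym2.map_mk]
  obtain ⟨hvmem, hall⟩ := hiv
  rcases Sym2.mem_iff.1 hvmem with hvx | hvy
  · subst hvx
    rcases hall y (Sym2.mem_mk_right _ _) with h | h
    · exact absurd h.symm hne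
    · rw [hvb, h, Sym2.eq_swap]
  · subst hvy
    rcases hall x (Sym2.mem_mk_left _ _) with h | h
    · exact absurd h hne
    · rw [hvb, h]

/-- **One orientation.**  If every `h`-set held too many pairs, then for an ordered pair of colours
`(a,b)` with `|X_a| < h < |X_a| + |X_b|` the half `X_a ∪ (lightest h − |X_a| vertices of X_b)` gives
`E(3h − n)·|X_b| < 3n·N_ab·(h − |X_a|)`. -/
theorem orient_ineq {e : ι → Sym2 V} {κ : V → Fin 3} (hl : ∀ i, ¬ (e i).IsDiag)
    (hb : ∀ i, ¬ ((e i).map κ).IsDiag) {h : ℕ}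
    (hcon : ∀ B : Finset V, B.card = h →
      (Fintype.card ι : ℝ) * (3 * h - Fintype.card V) < ((insideIdx e B).card : ℝ) * (3 * Fintype.card V))
    {a b : Fin 3} (hab : a ≠ b) (hxa : (cls κ a).card < h) (hsum : h < (cls κ a).card + (cls κ b).card) :
    (Fintype.card ι : ℝ) * (3 * h - Fintype.card V) * (cls κ b).card
      < 3 * (Fintype.card V : ℝ) * (btw e κ a b).card * ((h : ℝ) - (cls κ a).card) := by
  classical
  obtain ⟨T, hTsub, hTcard, hTw⟩ := exists_subset_small_weight (h - (cls κ a).card) (cls κ b).card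
    (cls κ b) (fun v => (star e κ a v).card) rfl (by omega)
  have hdisj : Disjoint (cls κ a) T := by
    rw [Finset.disjoint_left]
    intro v hva hvT
    exact hab ((mem_cls.1 hva).symm.trans (mem_cls.1 (hTsub hvT)))
  have hBcard : (cls κ a ∪ T).card = h := by
    rw [card_union_of_disjoint hdisj, hTcard]
    omega
  have h1 := hcon _ hBcard
  have h2 : (insideIdx e (cls κ a ∪ T)).card ≤ ∑ v ∈ T, (star e κ a v).card :=
    card_insideIdx_union_le hb hTsub
  have h3 : ∑ v ∈ cls κ b, (star e κ a v).card ≤ (btw e κ a b).card := sum_card_star_le hl hab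
  have h4 : (insideIdx e (cls κ a ∪ T)).card * (cls κ b).card
      ≤ (btw e κ a b).card * (h - (cls κ a).card) :=
    calc (insideIdx e (cls κ a ∪ T)).card * (cls κ b).card
        ≤ (∑ v ∈ T, (star e κ a v).card) * (cls κ b).card := Nat.mul_le_mul_right _ h2
      _ ≤ (∑ v ∈ cls κ b, (star e κ a v).card) * (h - (cls κ a).card) := by
          simpa using hTw
      _ ≤ (btw e κ a b).card * (h - (cls κ a).card) := Nat.mul_le_mul_right _ h3
  have h4' : ((insideIdx e (cls κ a ∪ T)).card : ℝ) * (cls κ b).card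
      ≤ (btw e κ a b).card * ((h : ℝ) - (cls κ a).card) := by
    have ht' : (((h - (cls κ a).card : ℕ)) : ℝ) = (h : ℝ) - (cls κ a).card := by
      rw [Nat.cast_sub hxa.le]
    rw [← ht']
    exact_mod_cast h4
  have hxb : (0 : ℝ) < (cls κ b).card := by
    have : 0 < (cls κ b).card := by omega
    exact_mod_cast this
  have hn0 : (0 : ℝ) ≤ 3 * (Fintype.card V : ℝ) := by positivity
  calc (Fintype.card ι : ℝ) * (3 * h - Fintype.card V) * (cls κ b).card
      < ((insideIdx e (cls κ a ∪ T)).card : ℝ) * (3 * Fintype.card V) * (cls κ b).card :=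
        mul_lt_mul_of_pos_right h1 hxb
    _ = 3 * (Fintype.card V : ℝ) * (((insideIdx e (cls κ a ∪ T)).card : ℝ) * (cls κ b).card) := by ring
    _ ≤ 3 * (Fintype.card V : ℝ) * ((btw e κ a b).card * ((h : ℝ) - (cls κ a).card)) :=
        mul_le_mul_of_nonneg_left h4' hn0
    _ = 3 * (Fintype.card V : ℝ) * (btw e κ a b).card * ((h : ℝ) - (cls κ a).card) := by ring

/-- **The real-arithmetic core.**  The six oriented inequalities are jointly infeasible (AM–HM). -/
theorem six_orient_contra {K n E x0 x1 x2 N01 N02 N12 hh : ℝ} (hK : K = E * (3 * hh - n))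
    (hKnn : 0 ≤ K) (hn0 : 0 ≤ n) (hh0 : 0 ≤ hh) (hx0 : 0 ≤ x0) (hx1 : 0 ≤ x1) (hx2 : 0 ≤ x2)
    (hN01 : 0 ≤ N01) (hN02 : 0 ≤ N02) (hN12 : 0 ≤ N12)
    (hpart : x0 + x1 + x2 = n) (hNE : N01 + N02 + N12 ≤ E)
    (i01 : K * x1 < 3 * n * N01 * (hh - x0)) (i10 : K * x0 < 3 * n * N01 * (hh - x1))
    (i02 : K * x2 < 3 * n * N02 * (hh - x0)) (i20 : K * x0 < 3 * n * N02 * (hh - x2))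
    (i12 : K * x2 < 3 * n * N12 * (hh - x1)) (i21 : K * x1 < 3 * n * N12 * (hh - x2)) : False := by
  -- the three pair inequalities (sum of the two orientations)
  have c2 : K * (x0 + x1) < 3 * n * N01 * (2 * hh - (x0 + x1)) := by linarith
  have c1 : K * (x0 + x2) < 3 * n * N02 * (2 * hh - (x0 + x2)) := by linarith
  have c0 : K * (x1 + x2) < 3 * n * N12 * (2 * hh - (x1 + x2)) := by linarith
  -- positivity of the denominators (each right-hand side is positive, the left-hand sides are ≥ 0)
  have p2 : 0 ≤ K * (x0 + x1) := mul_nonneg hKnn (by linarith)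
  have p1 : 0 ≤ K * (x0 + x2) := mul_nonneg hKnn (by linarith)
  have p0 : 0 ≤ K * (x1 + x2) := mul_nonneg hKnn (by linarith)
  have y2 : 0 < 2 * hh - (x0 + x1) := by
    by_contra hle
    have : 3 * n * N01 * (2 * hh - (x0 + x1)) ≤ 0 :=
      mul_nonpos_of_nonneg_of_nonpos (by positivity) (not_lt.1 hle)
    linarith
  have y1 : 0 < 2 * hh - (x0 + x2) := by
    by_contra hle
    have : 3 * n * N02 * (2 * hh - (x0 + x2)) ≤ 0 :=
      mul_nonpos_of_nonneg_of_nonpos (by positivity) (not_lt.1 hle)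
    linarith
  have y0 : 0 < 2 * hh - (x1 + x2) := by
    by_contra hle
    have : 3 * n * N12 * (2 * hh - (x1 + x2)) ≤ 0 :=
      mul_nonpos_of_nonneg_of_nonpos (by positivity) (not_lt.1 hle)
    linarith
  have d2 : K * (x0 + x1) / (2 * hh - (x0 + x1)) < 3 * n * N01 := by rw [div_lt_iff₀ y2]; linarith
  have d1 : K * (x0 + x2) / (2 * hh - (x0 + x2)) < 3 * n * N02 := by rw [div_lt_iff₀ y1]; linarith
  have d0 : K * (x1 + x2) / (2 * hh - (x1 + x2)) < 3 * n * N12 := by rw [div_lt_iff₀ y0]; linarith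
  have ham := amhm_aux (nn := n) (hh := hh) y0 y1 y2 hh0 (by linarith)
  have hpos : 0 < 3 * hh - n := by linarith
  have e1 : K * (3 * n / (3 * hh - n)) = 3 * n * E := by
    rw [hK]
    field_simp
  have e2 : K * ((x1 + x2) / (2 * hh - (x1 + x2)) + (x0 + x2) / (2 * hh - (x0 + x2))
      + (x0 + x1) / (2 * hh - (x0 + x1)))
      = K * (x1 + x2) / (2 * hh - (x1 + x2)) + K * (x0 + x2) / (2 * hh - (x0 + x2))
        + K * (x0 + x1) / (2 * hh - (x0 + x1)) := by ring
  have step := mul_le_mul_of_nonneg_left ham hKnn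
  rw [e1, e2] at step
  have : 3 * n * (N12 + N02 + N01) ≤ 3 * n * E := mul_le_mul_of_nonneg_left (by linarith) (by positivity)
  linarith

/-- **TRIPARTITE CUT LEMMA.**  A loopless pair family `e : ι → Sym2 V` properly 3-coloured by `κ`
(every pair bichromatic), `2h ≤ |V| ≤ 3h`: some `h`-set contains at most `|ι|·(3h − |V|)/(3|V|)` of the
pairs — at `h = |V|/2`, at most `|ι|/6`.  (Largest class if one has `≥ h` vertices; else, for each ordered
colour pair, a class plus the lightest part of a second class, and AM–HM over the class sizes; equality
forces balanced classes and equidistributed pairs.) -/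
theorem exists_cut_few_inside (κ : V → Fin 3) (e : ι → Sym2 V) (hl : ∀ i, ¬ (e i).IsDiag)
    (hb : ∀ i, ¬ ((e i).map κ).IsDiag) {h : ℕ} (h2 : 2 * h ≤ Fintype.card V)
    (h3 : Fintype.card V ≤ 3 * h) :
    ∃ B : Finset V, B.card = h ∧
      ((insideIdx e B).card : ℝ) * (3 * Fintype.card V) ≤ (Fintype.card ι : ℝ) * (3 * h - Fintype.card V) := by
  classical
  by_cases hbig : ∃ a, h ≤ (cls κ a).card
  · obtain ⟨a, ha⟩ := hbig
    obtain ⟨B, hBsub, hBcard⟩ := exists_subset_card_eq ha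
    refine ⟨B, hBcard, ?_⟩
    have h0 : insideIdx e B = ∅ := by
      rw [eq_empty_iff_forall_notMem]
      intro i hi
      rw [mem_insideIdx] at hi
      obtain ⟨x, y, hxy⟩ := exists_eq_mk (e i)
      apply hb i
      rw [hxy, Sym2.map_mk, Sym2.mk_isDiag_iff]
      have hx := mem_cls.1 (hBsub (hi x (by rw [hxy]; exact Sym2.mem_mk_left x y)))
      have hy := mem_cls.1 (hBsub (hi y (by rw [hxy]; exact Sym2.mem_mk_right x y)))
      rw [hx, hy]
    rw [h0, card_empty, Nat.cast_zero, zero_mul]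
    have : (Fintype.card V : ℝ) ≤ 3 * h := by exact_mod_cast h3
    exact mul_nonneg (Nat.cast_nonneg _) (by linarith)
  · push Not at hbig
    by_contra hcon
    push Not at hcon
    have hpart := card_cls_sum κ
    have hx0 := hbig 0
    have hx1 := hbig 1
    have hx2 := hbig 2
    have i01 := orient_ineq hl hb hcon (show (0 : Fin 3) ≠ 1 by decide) hx0 (by omega)
    have i10 := orient_ineq hl hb hcon (show (1 : Fin 3) ≠ 0 by decide) hx1 (by omega)
    have i02 := orient_ineq hl hb hcon (show (0 : Fin 3) ≠ 2 by decide) hx0 (by omega)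
    have i20 := orient_ineq hl hb hcon (show (2 : Fin 3) ≠ 0 by decide) hx2 (by omega)
    have i12 := orient_ineq hl hb hcon (show (1 : Fin 3) ≠ 2 by decide) hx1 (by omega)
    have i21 := orient_ineq hl hb hcon (show (2 : Fin 3) ≠ 1 by decide) hx2 (by omega)
    rw [btw_comm e κ 1 0] at i10
    rw [btw_comm e κ 2 0] at i20
    rw [btw_comm e κ 2 1] at i21
    have hh3 : (Fintype.card V : ℝ) ≤ 3 * h := by exact_mod_cast h3
    exact six_orient_contra rfl (mul_nonneg (Nat.cast_nonneg _) (by linarith)) (Nat.cast_nonneg _)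
      (Nat.cast_nonneg _) (Nat.cast_nonneg _) (Nat.cast_nonneg _) (Nat.cast_nonneg _)
      (Nat.cast_nonneg _) (Nat.cast_nonneg _) (Nat.cast_nonneg _)
      (by exact_mod_cast hpart) (by exact_mod_cast card_btw_sum_le e κ) i01 i10 i02 i20 i12 i21

end Tripartite

/-! ### §2  Two-pair unit systems: a near-balanced set splitting few units -/

section Units

variable {n m : ℕ}

/-- `Γ − π_J`: the frame and every unit outside `J` (verbatim copy of `Cruxes/FoolingMeasure/RobustEngine.lean`'s
`P4g10.gammaMinusSet`; crux workfiles do not import each other). -/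
def gammaMinusSet {V ι : Type*} [DecidableEq V] [Fintype ι] [DecidableEq ι] (W : Finset (Sym2 V))
    (π : ι → Finset (Sym2 V)) (J : Finset ι) : Finset (Sym2 V) :=
  W ∪ (univ.filter fun j => j ∉ J).biUnion π

/-- Membership in `Γ − π_J`. -/
theorem mem_gammaMinusSet {V ι : Type*} [DecidableEq V] [Fintype ι] [DecidableEq ι] {W : Finset (Sym2 V)}
    {π : ι → Finset (Sym2 V)} {J : Finset ι} {e : Sym2 V} :
    e ∈ gammaMinusSet W π J ↔ e ∈ W ∨ ∃ j, j ∉ J ∧ e ∈ π j := by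
  simp [gammaMinusSet]

/-- `Γ − π_{{i}} = Γ − πᵢ`. -/
theorem gammaMinusSet_singleton {V ι : Type*} [DecidableEq V] [Fintype ι] [DecidableEq ι] (W : Finset (Sym2 V))
    (π : ι → Finset (Sym2 V)) (i : ι) : gammaMinusSet W π {i} = gammaMinus W π i := by
  ext e
  simp [mem_gammaMinusSet, mem_gammaMinus]

/-! `r`-ROBUST D2 (`D2ᵣ`, the unfolded body of `P4g10.RobustD2 W π r`; kept unfolded here so that no
`def : Prop` is vendored): `∀ J, r ≤ |J| → (Γ − π_J) 3-colourable`; `r = 1` is the engine's exactness D2. -/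

/-- Exact D2 is `D2₁`. -/
theorem robustD2_one_of_D2 (W : Finset (Sym2 (Fin n))) (π : Fin m → Finset (Sym2 (Fin n)))
    (hD2 : ∀ i, (SimpleGraph.fromEdgeSet (↑(gammaMinus W π i) : Set (Sym2 (Fin n)))).Colorable 3) :
    ∀ J : Finset (Fin m), 1 ≤ J.card →
      (SimpleGraph.fromEdgeSet (↑(gammaMinusSet W π J) : Set (Sym2 (Fin n)))).Colorable 3 := by
  intro J hJ
  obtain ⟨i, hi⟩ := card_pos.1 (by omega : 0 < J.card)
  have hcol := hD2 i
  rw [colorable_iff_exists_not_mem_killSet] at hcol ⊢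
  obtain ⟨c, hc⟩ := hcol
  refine ⟨c, fun h => hc (killSet_mono ?_ h)⟩
  intro e he
  rw [mem_gammaMinusSet] at he
  rw [mem_gammaMinus]
  rcases he with hw | ⟨j, hj, hej⟩
  · exact Or.inl hw
  · exact Or.inr ⟨j, fun hji => hj (hji ▸ hi), hej⟩

/-- Looplessness of every pair of every unit follows from the engine's `tg`-form of D1. -/
theorem not_isDiag_of_tg (W : Finset (Sym2 (Fin n))) (π : Fin m → Finset (Sym2 (Fin n)))
    (hne : ∀ i, (π i).Nonempty)
    (hl : ∀ t : Fin m → Sym2 (Fin n), (∀ i, t i ∈ π i) → ∀ e ∈ tg W t, ¬ e.IsDiag) :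
    ∀ i, ∀ e ∈ π i, ¬ e.IsDiag := by
  classical
  intro i e he
  let t : Fin m → Sym2 (Fin n) := fun j => if j = i then e else (hne j).choose
  have ht : ∀ j, t j ∈ π j := by
    intro j
    by_cases hj : j = i
    · subst hj
      simp [t, he]
    · simp only [t, if_neg hj]
      exact (hne j).choose_spec
  exact hl t ht e (mem_tg.2 (Or.inr ⟨i, by simp [t]⟩))

/-- A 3-colouring of `Γ − π_J` (as a graph) is proper on every loopless pair of every unit outside `J`. -/
theorem exists_proper_off_of_colorable (W : Finset (Sym2 (Fin n))) (π : Fin m → Finset (Sym2 (Fin n)))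
    (hloop : ∀ i, ∀ e ∈ π i, ¬ e.IsDiag) (J : Finset (Fin m))
    (hcol : (SimpleGraph.fromEdgeSet (↑(gammaMinusSet W π J) : Set (Sym2 (Fin n)))).Colorable 3) :
    ∃ κ : Fin n → Fin 3, ∀ j, j ∉ J → ∀ e ∈ π j, ¬ (e.map κ).IsDiag := by
  rw [colorable_iff_exists_not_mem_killSet] at hcol
  obtain ⟨κ, hκ⟩ := hcol
  refine ⟨κ, fun j hj e he hmono => hκ ?_⟩
  rw [mem_killSet]
  exact ⟨e, mem_gammaMinusSet.2 (Or.inr ⟨j, hj, he⟩), hloop j e he, hmono⟩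

/-- **FEW SPLIT UNITS FROM A COLOURING WITNESS.**  `π`: `m` units of two loopless pairs on `Fin n`; `κ`: a
3-colouring under which every pair of every unit outside `J` is bichromatic.  For `2h ≤ n ≤ 3h` some `h`-set
`B` satisfies `#splitUnits π B · 3n ≤ |J|·3n + 2(m − |J|)(3h − n)`. -/
theorem splitUnits_le_of_witness (π : Fin m → Finset (Sym2 (Fin n))) (h2 : ∀ i, (π i).card = 2)
    (hloop : ∀ i, ∀ e ∈ π i, ¬ e.IsDiag) (J : Finset (Fin m)) (κ : Fin n → Fin 3)
    (hκ : ∀ i, i ∉ J → ∀ e ∈ π i, ¬ (e.map κ).IsDiag) {h : ℕ} (hh2 : 2 * h ≤ n) (hh3 : n ≤ 3 * h) :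
    ∃ B : Finset (Fin n), B.card = h ∧
      ((splitUnits π B).card : ℝ) * (3 * n)
        ≤ (J.card : ℝ) * (3 * n) + 2 * ((m : ℝ) - J.card) * (3 * h - n) := by
  classical
  set S : Finset (Fin m × Sym2 (Fin n)) := (univ \ J).biUnion fun i => (π i).image (Prod.mk i) with hSdef
  have hmemS : ∀ p : Fin m × Sym2 (Fin n), p ∈ S ↔ p.1 ∉ J ∧ p.2 ∈ π p.1 := by
    intro p
    simp only [hSdef, mem_biUnion, mem_image, mem_sdiff, mem_univ, true_and]
    constructor
    · rintro ⟨i, hi, e, he, rfl⟩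
      exact ⟨hi, he⟩
    · rintro ⟨h1, h2⟩
      exact ⟨p.1, h1, p.2, h2, rfl⟩
  have hScard : S.card ≤ 2 * (m - J.card) := by
    calc S.card ≤ ∑ i ∈ univ \ J, ((π i).image (Prod.mk i)).card := card_biUnion_le
      _ ≤ ∑ i ∈ univ \ J, 2 := sum_le_sum fun i _ => card_image_le.trans (h2 i).le
      _ = 2 * (m - J.card) := by
          rw [sum_const, smul_eq_mul, card_univ_sdiff, Fintype.card_fin, mul_comm]
  have hl' : ∀ p : S, ¬ ((fun q : S => q.1.2) p).IsDiag := fun p =>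
    hloop _ _ ((hmemS p.1).1 p.2).2
  have hb' : ∀ p : S, ¬ (((fun q : S => q.1.2) p).map κ).IsDiag := fun p =>
    hκ _ ((hmemS p.1).1 p.2).1 _ ((hmemS p.1).1 p.2).2
  obtain ⟨B, hB, hineq⟩ := exists_cut_few_inside (ι := S) κ (fun q : S => q.1.2) hl' hb' (h := h)
    (by rwa [Fintype.card_fin]) (by rwa [Fintype.card_fin])
  rw [Fintype.card_fin, Fintype.card_coe] at hineq
  refine ⟨B, hB, ?_⟩
  set Out := (univ \ J).filter fun i => ∃ e ∈ π i, ∀ v ∈ e, v ∈ B with hOut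
  have hsub : splitUnits π B ⊆ J ∪ Out := by
    intro i hi
    rw [mem_splitUnits] at hi
    rw [mem_union]
    by_cases hiJ : i ∈ J
    · exact Or.inl hiJ
    · refine Or.inr ?_
      rw [hOut, mem_filter, mem_sdiff]
      exact ⟨⟨mem_univ _, hiJ⟩, hi.1⟩
  have hOutle : Out.card ≤ (insideIdx (fun q : S => q.1.2) B).card := by
    have : Out ⊆ (insideIdx (fun q : S => q.1.2) B).image (fun q => q.1.1) := by
      intro i hi
      rw [hOut, mem_filter, mem_sdiff] at hi
      obtain ⟨⟨-, hiJ⟩, e, he, heB⟩ := hi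
      rw [mem_image]
      refine ⟨⟨(i, e), (hmemS _).2 ⟨hiJ, he⟩⟩, ?_, rfl⟩
      rw [mem_insideIdx]
      exact heB
    exact (card_le_card this).trans card_image_le
  have hsplit : (splitUnits π B).card ≤ J.card + (insideIdx (fun q : S => q.1.2) B).card :=
    (card_le_card hsub).trans ((card_union_le _ _).trans (Nat.add_le_add_left hOutle _))
  have hJm : J.card ≤ m := by simpa using card_le_univ J
  have e1 : ((splitUnits π B).card : ℝ) ≤ J.card + (insideIdx (fun q : S => q.1.2) B).card := by
    exact_mod_cast hsplit
  have e2 : (S.card : ℝ) ≤ 2 * ((m : ℝ) - J.card) := by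
    have : ((2 * (m - J.card) : ℕ) : ℝ) = 2 * ((m : ℝ) - J.card) := by
      push_cast [Nat.cast_sub hJm]
      ring
    rw [← this]
    exact_mod_cast hScard
  have h3n : (0 : ℝ) ≤ 3 * h - n := by
    have : (n : ℝ) ≤ 3 * h := by exact_mod_cast hh3
    linarith
  have hn0 : (0 : ℝ) ≤ 3 * (n : ℝ) := by positivity
  have e3 := mul_le_mul_of_nonneg_right e2 h3n
  calc ((splitUnits π B).card : ℝ) * (3 * n)
      ≤ ((J.card : ℝ) + (insideIdx (fun q : S => q.1.2) B).card) * (3 * n) :=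
        mul_le_mul_of_nonneg_right e1 hn0
    _ = (J.card : ℝ) * (3 * n) + ((insideIdx (fun q : S => q.1.2) B).card : ℝ) * (3 * n) := by ring
    _ ≤ (J.card : ℝ) * (3 * n) + (S.card : ℝ) * (3 * h - n) := by linarith
    _ ≤ (J.card : ℝ) * (3 * n) + 2 * ((m : ℝ) - J.card) * (3 * h - n) := by linarith

/-- The same from a 3-colouring of `Γ − π_J`. -/
theorem splitUnits_le_of_colorable_off (W : Finset (Sym2 (Fin n))) (π : Fin m → Finset (Sym2 (Fin n)))
    (h2 : ∀ i, (π i).card = 2) (hloop : ∀ i, ∀ e ∈ π i, ¬ e.IsDiag) (J : Finset (Fin m))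
    (hcol : (SimpleGraph.fromEdgeSet (↑(gammaMinusSet W π J) : Set (Sym2 (Fin n)))).Colorable 3)
    {h : ℕ} (hh2 : 2 * h ≤ n) (hh3 : n ≤ 3 * h) :
    ∃ B : Finset (Fin n), B.card = h ∧
      ((splitUnits π B).card : ℝ) * (3 * n)
        ≤ (J.card : ℝ) * (3 * n) + 2 * ((m : ℝ) - J.card) * (3 * h - n) := by
  obtain ⟨κ, hκ⟩ := exists_proper_off_of_colorable W π hloop J hcol
  exact splitUnits_le_of_witness π h2 hloop J κ hκ hh2 hh3

/-- **TRIPARTITE CUT WALL, exact form.**  Under the engine's D2 at one unit `i` (`Γ_i⁻` 3-colourable):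
some `h`-set splits at most `1 + 2(m − 1)(3h − n)/(3n)` units (`2h ≤ n ≤ 3h`). -/
theorem splitUnits_le_of_D2 (W : Finset (Sym2 (Fin n))) (π : Fin m → Finset (Sym2 (Fin n)))
    (h2 : ∀ i, (π i).card = 2) (hloop : ∀ i, ∀ e ∈ π i, ¬ e.IsDiag) (i : Fin m)
    (hD2i : (SimpleGraph.fromEdgeSet (↑(gammaMinus W π i) : Set (Sym2 (Fin n)))).Colorable 3)
    {h : ℕ} (hh2 : 2 * h ≤ n) (hh3 : n ≤ 3 * h) :
    ∃ B : Finset (Fin n), B.card = h ∧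
      ((splitUnits π B).card : ℝ) * (3 * n) ≤ 3 * n + 2 * ((m : ℝ) - 1) * (3 * h - n) := by
  have hcol : (SimpleGraph.fromEdgeSet (↑(gammaMinusSet W π {i}) : Set (Sym2 (Fin n)))).Colorable 3 := by
    rwa [gammaMinusSet_singleton]
  obtain ⟨B, hB, hle⟩ := splitUnits_le_of_colorable_off W π h2 hloop {i} hcol hh2 hh3
  refine ⟨B, hB, ?_⟩
  simpa using hle

/-- **TRIPARTITE CUT WALL, robust form.**  Under `D2ᵣ` (= `P4g10.RobustD2 W π r` unfolded) with `r ≤ m`: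
some `h`-set splits at most `r + 2(m − r)(3h − n)/(3n)` units. -/
theorem splitUnits_le_of_robustD2 (W : Finset (Sym2 (Fin n))) (π : Fin m → Finset (Sym2 (Fin n)))
    (h2 : ∀ i, (π i).card = 2) (hloop : ∀ i, ∀ e ∈ π i, ¬ e.IsDiag) {r : ℕ}
    (hD2r : ∀ J : Finset (Fin m), r ≤ J.card →
      (SimpleGraph.fromEdgeSet (↑(gammaMinusSet W π J) : Set (Sym2 (Fin n)))).Colorable 3)
    (hr : r ≤ m) {h : ℕ} (hh2 : 2 * h ≤ n) (hh3 : n ≤ 3 * h) :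
    ∃ B : Finset (Fin n), B.card = h ∧
      ((splitUnits π B).card : ℝ) * (3 * n) ≤ (r : ℝ) * (3 * n) + 2 * ((m : ℝ) - r) * (3 * h - n) := by
  classical
  obtain ⟨J, -, hJ⟩ := exists_subset_card_eq (s := (univ : Finset (Fin m))) (n := r)
    (by rw [card_univ, Fintype.card_fin]; exact hr)
  obtain ⟨B, hB, hle⟩ := splitUnits_le_of_colorable_off W π h2 hloop J (hD2r J hJ.ge) hh2 hh3
  refine ⟨B, hB, ?_⟩
  rw [hJ] at hle
  exact hle

/-! ### §3  The unit floor `3T ≤ m + 2r` at the cut `|B| = ⌊n/2⌋` -/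

/-- Arithmetic of the floor: from the cut bound at `h = ⌊n/2⌋`. -/
theorem mul_three_le_of_cut_bound {s r : ℝ} (hn : 1 ≤ n) (hr : r ≤ m)
    (hle : s * (3 * n) ≤ r * (3 * n) + 2 * ((m : ℝ) - r) * (3 * ((n / 2 : ℕ) : ℝ) - n)) :
    s * 3 ≤ m + 2 * r := by
  have hn0 : (0 : ℝ) < n := by exact_mod_cast (by omega : 0 < n)
  have hq : ((n / 2 : ℕ) : ℝ) ≤ (n : ℝ) / 2 := Nat.cast_div_le
  have h1 : 2 * ((m : ℝ) - r) * (3 * ((n / 2 : ℕ) : ℝ) - n) ≤ ((m : ℝ) - r) * n := by nlinarith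
  have h2 : s * (3 * n) ≤ ((m : ℝ) + 2 * r) * n := by linarith
  by_contra hcon
  have : ((m : ℝ) + 2 * r) * n < s * (3 * n) := by nlinarith
  linarith

/-- **`3T ≤ m + 2r` (robust).**  If `D2ᵣ` holds (`r ≤ m`, `n ≥ 2`) and every `⌊n/2⌋`-set splits at least `T`
units, then `3T ≤ m + 2r`. -/
theorem three_mul_le_of_spreadAt_half_robust (W : Finset (Sym2 (Fin n))) (π : Fin m → Finset (Sym2 (Fin n)))
    (h2 : ∀ i, (π i).card = 2) (hloop : ∀ i, ∀ e ∈ π i, ¬ e.IsDiag) {r : ℕ}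
    (hD2r : ∀ J : Finset (Fin m), r ≤ J.card →
      (SimpleGraph.fromEdgeSet (↑(gammaMinusSet W π J) : Set (Sym2 (Fin n)))).Colorable 3)
    (hr : r ≤ m) (hn : 2 ≤ n) {T : ℝ} (hT : ∀ B : Finset (Fin n), B.card = n / 2 → T ≤ (splitUnits π B).card) :
    3 * T ≤ m + 2 * r := by
  obtain ⟨B, hB, hle⟩ := splitUnits_le_of_robustD2 W π h2 hloop hD2r hr (h := n / 2) (by omega) (by omega)
  have hs := mul_three_le_of_cut_bound (by omega) (by exact_mod_cast hr) hle
  have := hT B hB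
  linarith

/-- **`3T ≤ m + 2` IN THE ENGINE'S OWN TERMS.**  The four clauses of the landed spread reduction
(`AeaCutRectanglesFixedCutFooling.foolingMeasure_of_spreadSystem`; = `P4g10.ExactSpreadHypothesis`) at ONE
`n ≥ 2` with `ε·n ≥ 1/2` (so that `⌊n/2⌋` lies in the window) force `3·((n/2)·log₂ n + C·n) ≤ m + 2`:
a spread exact system needs `m ≥ (3/2)·n·log₂ n + 3C·n − 2` units (g5 UNIT FLOOR: `n·log₂ n + 2C·n`). -/
theorem three_mul_demand_le_of_exactSpreadAt {ε : ℝ} {C : ℕ} (hn : 2 ≤ n) (hεn : 1 / 2 ≤ ε * n)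
    (W : Finset (Sym2 (Fin n))) (π : Fin m → Finset (Sym2 (Fin n))) (h2 : ∀ i, (π i).card = 2)
    (hD1 : ∀ t : Fin m → Sym2 (Fin n), (∀ i, t i ∈ π i) →
      (∀ e ∈ tg W t, ¬ e.IsDiag) ∧ ¬ (SimpleGraph.fromEdgeSet (↑(tg W t) : Set (Sym2 (Fin n)))).Colorable 3)
    (hD2 : ∀ i, (SimpleGraph.fromEdgeSet (↑(gammaMinus W π i) : Set (Sym2 (Fin n)))).Colorable 3)
    (hspread : ∀ B : Finset (Fin n), (1 / 2 - ε) * (n : ℝ) ≤ B.card → (B.card : ℝ) ≤ (1 / 2 + ε) * n →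
      ∃ I : Finset (Fin m), (n : ℝ) / 2 * Real.logb 2 n + (C : ℝ) * n ≤ I.card ∧
        ∀ i ∈ I, (∃ e ∈ π i, ∀ v ∈ e, v ∈ B) ∧ (∃ e ∈ π i, ∃ v ∈ e, v ∉ B)) :
    3 * ((n : ℝ) / 2 * Real.logb 2 n + (C : ℝ) * n) ≤ m + 2 := by
  classical
  have hloop : ∀ i, ∀ e ∈ π i, ¬ e.IsDiag :=
    not_isDiag_of_tg W π (fun i => by rw [← card_pos, h2 i]; norm_num) fun t ht => (hD1 t ht).1
  have hdem : ∀ B : Finset (Fin n), B.card = n / 2 →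
      (n : ℝ) / 2 * Real.logb 2 n + (C : ℝ) * n ≤ (splitUnits π B).card := by
    intro B hB
    have hw1 : (1 / 2 - ε) * (n : ℝ) ≤ B.card := by
      rw [hB]
      have h' : n - 1 ≤ 2 * (n / 2) := by omega
      have h'' : ((n - 1 : ℕ) : ℝ) = (n : ℝ) - 1 := by
        rw [Nat.cast_sub (by omega)]
        simp
      have : (n : ℝ) - 1 ≤ 2 * ((n / 2 : ℕ) : ℝ) := by
        rw [← h'']
        exact_mod_cast h'
      linarith
    have hw2 : ((B.card : ℕ) : ℝ) ≤ (1 / 2 + ε) * n := by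
      rw [hB]
      have : ((n / 2 : ℕ) : ℝ) ≤ (n : ℝ) / 2 := Nat.cast_div_le
      have hε : 0 ≤ ε * n := by linarith
      linarith
    obtain ⟨I, hI, hIsplit⟩ := hspread B hw1 hw2
    have hsub : I ⊆ splitUnits π B := fun i hi => mem_splitUnits.2 (hIsplit i hi)
    exact hI.trans (by exact_mod_cast card_le_card hsub)
  rcases Nat.eq_zero_or_pos m with hm | hm
  · subst hm
    obtain ⟨B, -, hB⟩ := exists_subset_card_eq (s := (univ : Finset (Fin n))) (n := n / 2)
      (by rw [card_univ, Fintype.card_fin]; omega)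
    have h0 : (splitUnits π B).card = 0 := by
      rw [card_eq_zero]
      exact eq_empty_of_isEmpty _
    have := hdem B hB
    rw [h0] at this
    push_cast at this ⊢
    linarith
  · have := three_mul_le_of_spreadAt_half_robust W π h2 hloop (robustD2_one_of_D2 W π hD2) hm hn hdem
    push_cast at this
    linarith

end Units

end Summit.PneNP.PneNP.Cruxes.FoolingMeasure.P4g11
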